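import Summits.RiemannHypothesis.RiemannHypothesis.Theses.IntegerScrew
import Summits.RiemannHypothesis.RiemannHypothesis.Theorems.IntegerScrewScrewPolyFloorBump
import Summits.RiemannHypothesis.RiemannHypothesis.Theorems.IntegerScrewScrewPolyFloorShadow
import Summits.RiemannHypothesis.RiemannHypothesis.Theorems.IntegerScrewScrewPolyFloorEndgame
import Summits.RiemannHypothesis.RiemannHypothesis.Theorems.WeilCombCombSubcritical
import Summits.RiemannHypothesis.RiemannHypothesis.Theorems.WeilCombCombHelsonBound
import Literature.NumberTheory.LFunctions.WeilLogLatticeComb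
import Literature.NumberTheory.LFunctions.WeilExplicitFormulaProofs
import HarnessLib

/-!
# Line `weil-comb-floor` read as the skeleton of the route item `FloorOfRH` (stmt-RiemannHypothesis-15762)

`FloorOfRH : RiemannHypothesis → ∃ A c > 0, ∀ M x, c·M^{-A}·Σ_{2≤m≤M} x_m² ≤ x·S_M·x` — the floor law
UNDER RH, i.e. the non-RH half of the crux `ScrewPolyFloor` (stmt-RiemannHypothesis-15757;
`ScrewPolyFloor ↔ RiemannHypothesis ∧ FloorOfRH`, kernel-checked in the strategist evidence file
`IntegerScrewScrewPolyFloorSplit.lean`).  This file is the published line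
`Cruxes/ScrewPolyFloor/Lines/weil_comb_floor.lean` (planner b1; now the lead prover's ACTIVE skeleton
on the parent crux, skeleton 25174e92) RESTRICTED to the stubs that serve `FloorOfRH` — so that the
item `FloorOfRH` has its own registered skeleton with NO RH-strength stub in its cone:

* `stub_combDominated` (OPEN, L; signature VERBATIM the lead's registered stub on the parent, so one
  proof discharges both): under RH the Weil form of WeilComb's log-integer comb is dominated by
  `‖φ'‖₁'² ε⁻²` times the screw form;
* `stub_bumpWitness`, `stub_shadowBudget`, `stub_endgameComb` — ALREADY LANDED
  (`Theorems/IntegerScrewScrewPolyFloor{Bump,Shadow,Endgame}.lean`, p152172 / p152009 / p151957),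
  restated here by name, no `sorry`;
* composition `FloorOfRH_of` (sorry-free) from the four stubs, WeilComb's PROVED `analyticReduction`
  and `combHelsonBound_proof`; `floorOfRH : FloorOfRH` modulo the single sorry `stub_combDominated`.

THE LEVER (unchanged).  For `y` with `Σ_{m≤M} y_m = 0` the comb `g = Σ y_m ε⁻¹φ((·−log m)/ε)` has,
under RH, `Re Q(g) = lim_T Σ_{|γ|≤T} |φ̂(1/2+iεγ)|²|P_y(γ)|²` with `|φ̂(1/2+iεγ)| ≤ ‖φ'‖₁'/(ε|γ|)`, while
`y·S_M·y = Σ_γ |P_y(γ)|²/γ²` (Suzuki2023 Thm 1.1(2)); so `Re Q(g) ≤ ‖φ'‖₁'² ε⁻² · y·S_M·y`.  WeilComb's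
`analyticReduction` bounds `Re Q(g)` BELOW by `ε⁻¹‖φ‖₂²[(log(1/ε) − C)‖y‖² − Helson(y) − ε·shadow(y)]`,
Helson ≤ (log M + 1)‖y‖² (PROVED), shadow ≤ 12M²‖y‖² (PROVED); `ε = M^{−K}` gives the floor `c M^{−3K}`·…
-/

noncomputable section

-- `Summit.RiemannHypothesis.RiemannHypothesis.…` duplicates `RiemannHypothesis` BY DESIGN (D-0017).
set_option linter.dupNamespace false

namespace Summit.RiemannHypothesis.RiemannHypothesis.Cruxes.FloorOfRH.WeilCombFloor

open Literature.NumberTheory.LFunctions MeasureTheory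
open scoped BigOperators ComplexConjugate
open Finset

/-! ## Objects (proof-side abbreviations; the STUBS below are stated definition-free) -/

/-- WeilComb's log-integer comb with real coefficients `y`. -/
def comb (φ : ℝ → ℂ) (ε : ℝ) (M : ℕ) (y : ℕ → ℝ) : ℝ → ℂ :=
  fun x => ∑ m ∈ Icc 1 M, ((y m : ℝ) : ℂ) * ((ε : ℂ)⁻¹ * φ ((x - Real.log (m : ℝ)) / ε))

/-- `‖y‖²_M` in the shape produced by `analyticReduction`. -/
def l2 (M : ℕ) (y : ℕ → ℝ) : ℝ :=
  ∑ m ∈ Icc 1 M, ‖((y m : ℝ) : ℂ)‖ ^ 2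

/-- The von Mangoldt Helson form. -/
def helson (M : ℕ) (y : ℕ → ℝ) : ℝ :=
  2 * (∑ m ∈ Icc 1 M, ∑ n ∈ Icc 1 (M / m),
    ((ArithmeticFunction.vonMangoldt n : ℝ) : ℂ) / (Real.sqrt n : ℂ) * ((y (n * m) : ℝ) : ℂ) *
      conj ((y m : ℝ) : ℂ)).re

/-- The archimedean shadow of `analyticReduction`. -/
def archShadow (M : ℕ) (y : ℕ → ℝ) : ℝ :=
  5 * (∑ m ∈ Icc 1 M, ‖((y m : ℝ) : ℂ)‖ / Real.sqrt m) *
      (∑ m ∈ Icc 1 M, ‖((y m : ℝ) : ℂ)‖ * Real.sqrt m) +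
    2 * (∑ m ∈ Icc 1 M, ∑ m' ∈ (Icc 1 M).erase m,
      ‖((y m : ℝ) : ℂ)‖ * ‖((y m' : ℝ) : ℂ)‖ / |Real.log m - Real.log m'|) +
    2 * (∑ m ∈ Icc 1 M, ‖((y m : ℝ) : ℂ)‖) ^ 2

/-- The screw quadratic form on `{2, …, M}`. -/
def screwForm (M : ℕ) (y : ℕ → ℝ) : ℝ :=
  ∑ m ∈ Icc 2 M, ∑ m' ∈ Icc 2 M, zetaScrewKernel (Real.log m) (Real.log m') * (y m * y m')

/-! ## Stubs (definition-free statements = the signatures registered on the parent crux) -/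

/-- STUB S3 (OPEN, L — the load-bearing stub; verbatim the lead's registered `stub_combDominated`). -/
theorem stub_combDominated :
    _root_.RiemannHypothesis → ∀ φ : ℝ → ℂ, Literature.NumberTheory.LFunctions.IsWeilTest φ →
      ∀ (M : ℕ) (ε : ℝ) (y : ℕ → ℝ), 1 ≤ M → 0 < ε → ∑ m ∈ Finset.Icc 1 M, y m = 0 →
        (Literature.NumberTheory.LFunctions.weilQuadratic (fun x : ℝ => ∑ m ∈ Finset.Icc 1 M,
            ((y m : ℝ) : ℂ) * ((ε : ℂ)⁻¹ * φ ((x - Real.log (m : ℝ)) / ε)))).re ≤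
          Literature.NumberTheory.LFunctions.weilL1 (deriv φ) ^ 2 * ε⁻¹ ^ 2 *
            ∑ m ∈ Finset.Icc 2 M, ∑ m' ∈ Finset.Icc 2 M,
              Literature.NumberTheory.LFunctions.zetaScrewKernel (Real.log m) (Real.log m') * (y m * y m') := by
  sorry

/-- STUB S4 (LANDED p152172): one admissible bump. -/
theorem stub_bumpWitness :
    ∃ φ : ℝ → ℂ, Literature.NumberTheory.LFunctions.IsWeilTest φ ∧ tsupport φ ⊆ Set.Icc (-1) 1 ∧
      0 < Literature.NumberTheory.LFunctions.weilNorm2Sq φ ∧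
      0 < Literature.NumberTheory.LFunctions.weilL1 (deriv φ) :=
  Summit.RiemannHypothesis.RiemannHypothesis.Theorems.IntegerScrewScrewPolyFloor.stub_bumpWitness

/-- STUB S5 (LANDED p152009): the archimedean shadow is polynomially bounded. -/
theorem stub_shadowBudget :
    ∀ (M : ℕ) (y : ℕ → ℝ), 1 ≤ M →
      5 * (∑ m ∈ Finset.Icc 1 M, ‖((y m : ℝ) : ℂ)‖ / Real.sqrt m) *
            (∑ m ∈ Finset.Icc 1 M, ‖((y m : ℝ) : ℂ)‖ * Real.sqrt m) +
          2 * (∑ m ∈ Finset.Icc 1 M, ∑ m' ∈ (Finset.Icc 1 M).erase m,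
            ‖((y m : ℝ) : ℂ)‖ * ‖((y m' : ℝ) : ℂ)‖ / |Real.log m - Real.log m'|) +
          2 * (∑ m ∈ Finset.Icc 1 M, ‖((y m : ℝ) : ℂ)‖) ^ 2 ≤
        12 * (M : ℝ) ^ 2 * ∑ m ∈ Finset.Icc 1 M, ‖((y m : ℝ) : ℂ)‖ ^ 2 :=
  Summit.RiemannHypothesis.RiemannHypothesis.Theorems.IntegerScrewScrewPolyFloor.stub_shadowBudget

/-- STUB S6 (LANDED p151957): the parameter choice `ε = M^{-K}`. -/
theorem stub_endgameComb :
    ∀ (C N B : ℝ), 0 < N → 0 < B → ∃ (K : ℕ) (A c : ℝ), 0 < c ∧ ∀ M : ℕ, 2 ≤ M →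
      8 * ((M : ℝ) ^ K)⁻¹ * M ≤ 1 ∧
        c * (M : ℝ) ^ (-A) ≤
          ((M : ℝ) ^ K)⁻¹ * N / B *
            (Real.log (1 / ((M : ℝ) ^ K)⁻¹) - C - (Real.log M + 1) -
              ((M : ℝ) ^ K)⁻¹ * (12 * (M : ℝ) ^ 2)) :=
  Summit.RiemannHypothesis.RiemannHypothesis.Theorems.IntegerScrewScrewPolyFloor.stub_endgameComb

/-! ## Compositions (sorry-free) -/

/-- The Helson bound (WeilComb's `combHelsonBound_proof`, PROVED) on real vectors. -/
theorem helson_le (M : ℕ) (y : ℕ → ℝ) (hM : 1 ≤ M) :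
    helson M y ≤ (Real.log M + 1) * l2 M y := by
  have h := Summit.RiemannHypothesis.RiemannHypothesis.Theorems.combHelsonBound_proof
  unfold Summit.RiemannHypothesis.RiemannHypothesis.Theses.WeilComb.CombHelsonBound at h
  exact h M (fun m => ((y m : ℝ) : ℂ)) hM

/-- `l2 M y` dominates `Σ_{2 ≤ m ≤ M} y_m²`. -/
theorem sum_Icc_two_sq_le_l2 (M : ℕ) (y : ℕ → ℝ) :
    ∑ m ∈ Icc 2 M, y m ^ 2 ≤ l2 M y := by
  unfold l2
  have hsub : Icc 2 M ⊆ Icc 1 M := by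
    intro k hk
    simp only [Finset.mem_Icc] at hk ⊢
    omega
  have e : ∀ m, ‖((y m : ℝ) : ℂ)‖ ^ 2 = y m ^ 2 := fun m => by
    rw [Complex.norm_real, Real.norm_eq_abs, sq_abs]
  simp_rw [e]
  exact Finset.sum_le_sum_of_subset_of_nonneg hsub fun m _ _ => sq_nonneg _

/-- **`FloorOfRH` from the four stubs** (sorry-free composition; no RH-strength stub enters):
WeilComb's `analyticReduction` (PROVED) below, `stub_combDominated` above, Helson and shadow budgets,
and the parameter choice `ε = M^{-K}`. -/
theorem FloorOfRH_of
    (h3 : _root_.RiemannHypothesis → ∀ φ : ℝ → ℂ, IsWeilTest φ →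
      ∀ (M : ℕ) (ε : ℝ) (y : ℕ → ℝ), 1 ≤ M → 0 < ε → ∑ m ∈ Finset.Icc 1 M, y m = 0 →
        (weilQuadratic (fun x : ℝ => ∑ m ∈ Finset.Icc 1 M,
            ((y m : ℝ) : ℂ) * ((ε : ℂ)⁻¹ * φ ((x - Real.log (m : ℝ)) / ε)))).re ≤
          weilL1 (deriv φ) ^ 2 * ε⁻¹ ^ 2 *
            ∑ m ∈ Finset.Icc 2 M, ∑ m' ∈ Finset.Icc 2 M,
              zetaScrewKernel (Real.log m) (Real.log m') * (y m * y m'))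
    (h4 : ∃ φ : ℝ → ℂ, IsWeilTest φ ∧ tsupport φ ⊆ Set.Icc (-1) 1 ∧ 0 < weilNorm2Sq φ ∧
      0 < weilL1 (deriv φ))
    (h5 : ∀ (M : ℕ) (y : ℕ → ℝ), 1 ≤ M →
      5 * (∑ m ∈ Finset.Icc 1 M, ‖((y m : ℝ) : ℂ)‖ / Real.sqrt m) *
            (∑ m ∈ Finset.Icc 1 M, ‖((y m : ℝ) : ℂ)‖ * Real.sqrt m) +
          2 * (∑ m ∈ Finset.Icc 1 M, ∑ m' ∈ (Finset.Icc 1 M).erase m,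
            ‖((y m : ℝ) : ℂ)‖ * ‖((y m' : ℝ) : ℂ)‖ / |Real.log m - Real.log m'|) +
          2 * (∑ m ∈ Finset.Icc 1 M, ‖((y m : ℝ) : ℂ)‖) ^ 2 ≤
        12 * (M : ℝ) ^ 2 * ∑ m ∈ Finset.Icc 1 M, ‖((y m : ℝ) : ℂ)‖ ^ 2)
    (h6 : ∀ (C N B : ℝ), 0 < N → 0 < B → ∃ (K : ℕ) (A c : ℝ), 0 < c ∧ ∀ M : ℕ, 2 ≤ M →
      8 * ((M : ℝ) ^ K)⁻¹ * M ≤ 1 ∧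
        c * (M : ℝ) ^ (-A) ≤
          ((M : ℝ) ^ K)⁻¹ * N / B *
            (Real.log (1 / ((M : ℝ) ^ K)⁻¹) - C - (Real.log M + 1) -
              ((M : ℝ) ^ K)⁻¹ * (12 * (M : ℝ) ^ 2))) :
    -- the statement of `FloorOfRH`, UNFOLDED (so that `floorOfRH` below is the unique theorem of this
    -- file concluding the item by name, as the skeleton audit requires)
    _root_.RiemannHypothesis → ∃ A c : ℝ, 0 < c ∧ ∀ (M : ℕ) (x : ℕ → ℝ),
      c * (M : ℝ) ^ (-A) * ∑ m ∈ Finset.Icc 2 M, x m ^ 2 ≤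
        ∑ m ∈ Finset.Icc 2 M, ∑ m' ∈ Finset.Icc 2 M,
          zetaScrewKernel (Real.log m) (Real.log m') * (x m * x m') := by
  intro hRH
  obtain ⟨φ, hφ, hsupp, hN, hB⟩ := h4
  obtain ⟨C, hC⟩ :=
    Summit.RiemannHypothesis.RiemannHypothesis.Theorems.WeilCombSubcritical.analyticReduction
  obtain ⟨K, A, c, hc, hK⟩ := h6 C (weilNorm2Sq φ) (weilL1 (deriv φ) ^ 2) hN (by positivity)
  refine ⟨A, c, hc, fun M x => ?_⟩
  rcases lt_or_ge M 2 with hM | hM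
  · have hE : Finset.Icc 2 M = ∅ := Finset.Icc_eq_empty (by omega)
    simp [hE]
  · classical
    obtain ⟨h8, hmain⟩ := hK M hM
    have hM1 : 1 ≤ M := by omega
    have hMpos : (0 : ℝ) < (M : ℝ) := by exact_mod_cast (show 0 < M by omega)
    -- the parameter
    set ε : ℝ := ((M : ℝ) ^ K)⁻¹ with hεdef
    have hε : 0 < ε := by rw [hεdef]; positivity
    -- the test vector with vanishing sum
    set y : ℕ → ℝ := fun m => if m = 1 then -∑ k ∈ Finset.Icc 2 M, x k else x m with hydef
    have hsplit : Finset.Icc 1 M = insert 1 (Finset.Icc 2 M) := by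
      ext k
      simp only [Finset.mem_Icc, Finset.mem_insert]
      omega
    have h1notin : (1 : ℕ) ∉ Finset.Icc 2 M := by simp
    have hyx : ∀ k ∈ Finset.Icc 2 M, y k = x k := by
      intro k hk
      have hk1 : k ≠ 1 := by
        simp only [Finset.mem_Icc] at hk
        omega
      simp [hydef, hk1]
    have hy1 : y 1 = -∑ k ∈ Finset.Icc 2 M, x k := by simp [hydef]
    have hsum0 : ∑ m ∈ Finset.Icc 1 M, y m = 0 := by
      rw [hsplit, Finset.sum_insert h1notin, Finset.sum_congr rfl hyx, hy1]
      ring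
    -- the four analytic inputs
    have h8' : 8 * ε * M ≤ 1 := by rw [hεdef]; exact h8
    have hR := hC φ hφ hsupp ε hε M (fun m => ((y m : ℝ) : ℂ)) hM1 h8'
    have hD : (weilQuadratic (comb φ ε M y)).re ≤ weilL1 (deriv φ) ^ 2 * ε⁻¹ ^ 2 * screwForm M y :=
      h3 hRH φ hφ M ε y hM1 hε hsum0
    have hHel := helson_le M y hM1
    have hSh : archShadow M y ≤ 12 * (M : ℝ) ^ 2 * l2 M y := h5 M y hM1
    -- names for the atoms
    set N : ℝ := weilNorm2Sq φ with hNdef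
    set B : ℝ := weilL1 (deriv φ) ^ 2 with hBdef
    set L : ℝ := l2 M y with hLdef
    have hL0 : 0 ≤ L := Finset.sum_nonneg fun m _ => sq_nonneg _
    have hεN : 0 ≤ ε⁻¹ * N := mul_nonneg (inv_nonneg.2 hε.le) hN.le
    -- monotonicity inside the bracket of the analytic reduction
    have hmono : ε⁻¹ * N *
        (L * (Real.log (1 / ε) - C - (Real.log M + 1) - ε * (12 * (M : ℝ) ^ 2))) ≤
        ε⁻¹ * N * ((Real.log (1 / ε) - C) * L - helson M y - ε * archShadow M y) := by
      apply mul_le_mul_of_nonneg_left _ hεN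
      have a1 : helson M y ≤ (Real.log M + 1) * L := hHel
      have a2 : ε * archShadow M y ≤ ε * (12 * (M : ℝ) ^ 2 * L) :=
        mul_le_mul_of_nonneg_left hSh hε.le
      have e1 : L * (Real.log (1 / ε) - C - (Real.log M + 1) - ε * (12 * (M : ℝ) ^ 2)) =
          (Real.log (1 / ε) - C) * L - (Real.log M + 1) * L - ε * (12 * (M : ℝ) ^ 2 * L) := by
        ring
      rw [e1]
      linarith
    -- the analytic reduction, read on the comb with coefficients `y`
    have hR' : ε⁻¹ * N * ((Real.log (1 / ε) - C) * L - helson M y - ε * archShadow M y) ≤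
        (weilQuadratic (comb φ ε M y)).re := hR
    -- domination of the comb form by the screw form
    have hD' : (weilQuadratic (comb φ ε M y)).re ≤ B * ε⁻¹ ^ 2 * screwForm M y := by
      simpa only [hBdef] using hD
    have key : ε⁻¹ * N *
        (L * (Real.log (1 / ε) - C - (Real.log M + 1) - ε * (12 * (M : ℝ) ^ 2))) ≤
        B * ε⁻¹ ^ 2 * screwForm M y :=
      le_trans (le_trans hmono hR') hD'
    -- the screw form in the `x` variables
    have hQ : screwForm M y =
        ∑ m ∈ Icc 2 M, ∑ m' ∈ Icc 2 M,
          zetaScrewKernel (Real.log m) (Real.log m') * (x m * x m') := by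
      unfold screwForm
      exact Finset.sum_congr rfl fun m hm => Finset.sum_congr rfl fun m' hm' => by
        rw [hyx m hm, hyx m' hm']
    have hsqy : ∑ k ∈ Icc 2 M, x k ^ 2 = ∑ k ∈ Icc 2 M, y k ^ 2 :=
      Finset.sum_congr rfl fun k hk => by rw [hyx k hk]
    have hsq : ∑ m ∈ Icc 2 M, x m ^ 2 ≤ L := by
      rw [hsqy, hLdef]
      exact sum_Icc_two_sq_le_l2 M y
    have hcA : 0 ≤ c * (M : ℝ) ^ (-A) :=
      mul_nonneg hc.le (Real.rpow_nonneg (Nat.cast_nonneg M) _)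
    have hBε : 0 < B * ε⁻¹ ^ 2 := by positivity
    have hεne : ε ≠ 0 := hε.ne'
    have hBne : B ≠ 0 := by positivity
    set br : ℝ := Real.log (1 / ε) - C - (Real.log M + 1) - ε * (12 * (M : ℝ) ^ 2) with hbr
    have e3 : ε * N / B * br * L = (B * ε⁻¹ ^ 2)⁻¹ * (ε⁻¹ * N * (L * br)) := by
      field_simp
    have e4 : (B * ε⁻¹ ^ 2)⁻¹ * (B * ε⁻¹ ^ 2 * screwForm M y) = screwForm M y := by
      field_simp
    -- endgame: `c M^{-A} ≤ ε N/B · bracket`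
    have hmain' : c * (M : ℝ) ^ (-A) ≤
        ε * N / B * (Real.log (1 / ε) - C - (Real.log M + 1) - ε * (12 * (M : ℝ) ^ 2)) := by
      simpa only [hεdef, hNdef, hBdef] using hmain
    calc c * (M : ℝ) ^ (-A) * ∑ m ∈ Icc 2 M, x m ^ 2
        ≤ c * (M : ℝ) ^ (-A) * L := mul_le_mul_of_nonneg_left hsq hcA
      _ ≤ ε * N / B * br * L := mul_le_mul_of_nonneg_right hmain' hL0
      _ = (B * ε⁻¹ ^ 2)⁻¹ * (ε⁻¹ * N * (L * br)) := e3
      _ ≤ (B * ε⁻¹ ^ 2)⁻¹ * (B * ε⁻¹ ^ 2 * screwForm M y) :=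
          mul_le_mul_of_nonneg_left key (inv_nonneg.2 hBε.le)
      _ = screwForm M y := e4
      _ = ∑ m ∈ Icc 2 M, ∑ m' ∈ Icc 2 M,
            zetaScrewKernel (Real.log m) (Real.log m') * (x m * x m') := hQ

/-- THE SKELETON: the route item `FloorOfRH` BY NAME, modulo exactly one sorry (`stub_combDominated`). -/
theorem floorOfRH :
    Summit.RiemannHypothesis.RiemannHypothesis.Theses.IntegerScrew.FloorOfRH := by
  intro hRH
  exact FloorOfRH_of stub_combDominated stub_bumpWitness stub_shadowBudget stub_endgameComb hRH

end Summit.RiemannHypothesis.RiemannHypothesis.Cruxes.FloorOfRH.WeilCombFloor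

end
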